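import Summits.CriticalPhenomena.PercolationContinuityZ3.Theorems.PercNearOneGluingNoHeavyLowerTailSahiTripartitionULC
import Mathlib
import HarnessLib
import HarnessLib.Audit.Tags

/-!
# `NoHeavyLowerTail` (crux stmt-CriticalPhenomena-4575), master-family line P1 (gen 19):
# the BOTH-OUT inequality for ordered tripartitions — `#{X ∈ u}·#{Y,Z ∉ u} ≤ #all·#{X ∈ u, Y,Z ∉ u}` (THEOREM)

Support file (seat `prim-masterthm-p1`, gen 19; `--supports stmt-CriticalPhenomena-4575`), on top of `…SahiTripartitionULC` (gen 17).
Memo `run/shared/lean/prim/prim-masterthm/FROM-prim-masterthm-p1-g19-ULC-REFUTATION.md` §7.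

FKG on the first cell `X` (log-modular weight `2^{|Xᶜ|}`, `f = 1_u(X)`) against a window-monotone pattern density of `2^{Xᶜ}` yields one valid quadratic
inequality for the cell-count classes `(A₀,A₁,A₂,A₃)` of a monotone `u` per extreme ray of the cone of such densities: the member density (NA, tree),
the member-PAIR density (distance two, gen 19 `…DistanceTwo`), and — this file — the NON-MEMBER-PAIR density, which is antitone in the window
(`outPairIn_mul_pow_le`: restrict a non-member pair of `W` to `W' ⊆ W`):
**THEOREM `triCount_fst_mul_outPair_le`**: `#{X ∈ u}·#{Y ∉ u, Z ∉ u} ≤ #all·#{X ∈ u, Y ∉ u, Z ∉ u}`, i.e. `P(Y,Z ∉ u | X ∈ u) ≥ P(Y,Z ∉ u)`;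
in classes: `2A₁² + A₁A₂ ≥ 2A₀A₂ + A₀A₃` (= twice the Half-B slack plus `A₁A₂ − A₀A₃`).  Together with NA and distance two these are the PROVED faces of the
region of achievable block statistics (memo §7); gen 16 §9's free-weight EXMAX killer violates this one at three coordinates.
HONEST FRAMING: one proved inequality; Half B, PivotDichotomy, S₃^max remain OPEN. [this work]
-/

namespace Summit.CriticalPhenomena.PercolationContinuityZ3.Theorems

namespace SahiTripartition

open Finset

variable {ι : Type*} [Fintype ι] [DecidableEq ι]

/-! ### 1. Complementary non-member pairs inside a window -/

/-- `outPairIn u W` = number of `y ⊆ W` with `y ∉ u` and `W \ y ∉ u`. [this work] -/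
def outPairIn (u : Finset ι → Bool) (W : Finset ι) : ℕ := ((W.powerset).filter fun y => (!u y && !u (W \ y)) = true).card

omit [Fintype ι] in
/-- `outPairIn u W ≤ 2^{|W|}`. [this work] -/
theorem outPairIn_le_pow (u : Finset ι → Bool) (W : Finset ι) : outPairIn u W ≤ 2 ^ W.card := by
  unfold outPairIn; rw [← card_powerset]; exact card_filter_le _ _

omit [Fintype ι] in
/-- Restricting a non-member pair of `W` to a sub-window `W' ⊆ W` gives a non-member pair of `W'` (subsets of non-members are non-members),
at most `2^{|W \ W'|}` to one. [this work] -/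
theorem outPairIn_le_mul (u : Finset ι → Bool) (hu : Monotone u) {W W' : Finset ι} (h : W' ⊆ W) :
    outPairIn u W ≤ 2 ^ (W \ W').card * outPairIn u W' := by
  classical
  unfold outPairIn
  set A := (W.powerset).filter fun y => (!u y && !u (W \ y)) = true with hA
  set B := (W'.powerset).filter fun y => (!u y && !u (W' \ y)) = true with hB
  have hfalse : ∀ {s t : Finset ι}, s ⊆ t → u t = false → u s = false := by
    intro s t hst ht
    have hle : u s ≤ u t := hu hst
    rw [ht] at hle
    exact le_antisymm (hle.trans (by decide)) (Bool.false_le _)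
  have hmaps : ∀ y ∈ A, y ∩ W' ∈ B := by
    intro y hy
    rw [hA, mem_filter, mem_powerset, Bool.and_eq_true, Bool.not_eq_true', Bool.not_eq_true'] at hy
    rw [hB, mem_filter, mem_powerset, Bool.and_eq_true, Bool.not_eq_true', Bool.not_eq_true']
    refine ⟨inter_subset_right, hfalse inter_subset_left hy.2.1, hfalse ?_ hy.2.2⟩
    intro v hv
    rw [mem_sdiff] at hv ⊢
    exact ⟨h hv.1, fun hvy => hv.2 (mem_inter.mpr ⟨hvy, hv.1⟩)⟩
  have himg : A.image (fun y => y ∩ W') ⊆ B := by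
    intro b hb
    obtain ⟨y, hy, rfl⟩ := mem_image.mp hb
    exact hmaps y hy
  have hfib : ∀ b ∈ A.image (fun y => y ∩ W'), (A.filter fun y => y ∩ W' = b).card ≤ 2 ^ (W \ W').card := by
    intro b _
    rw [← card_powerset]
    refine card_le_card_of_injOn (fun y => y \ W') (fun y hy => ?_) (fun y₁ hy₁ y₂ hy₂ heq => ?_)
    · rw [mem_coe, mem_filter, hA, mem_filter, mem_powerset] at hy
      rw [mem_coe, mem_powerset]
      exact sdiff_subset_sdiff hy.1.1 subset_rfl
    · rw [mem_coe, mem_filter] at hy₁ hy₂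
      have e1 : y₁ ∩ W' ∪ y₁ \ W' = y₁ := sup_inf_sdiff y₁ W'
      have e2 : y₂ ∩ W' ∪ y₂ \ W' = y₂ := sup_inf_sdiff y₂ W'
      have heq' : y₁ \ W' = y₂ \ W' := heq
      rw [← e1, ← e2, hy₁.2, hy₂.2, heq']
  calc A.card ≤ 2 ^ (W \ W').card * (A.image fun y => y ∩ W').card := card_le_mul_card_image _ _ hfib
    _ ≤ 2 ^ (W \ W').card * B.card := Nat.mul_le_mul_left _ (card_le_card himg)

omit [Fintype ι] in
/-- The non-member-pair density is antitone in the window: for `W' ⊆ W`, `outPairIn W / 2^{|W|} ≤ outPairIn W' / 2^{|W'|}` (cross-multiplied). [this work] -/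
theorem outPairIn_mul_pow_le (u : Finset ι → Bool) (hu : Monotone u) {W W' : Finset ι} (h : W' ⊆ W) :
    outPairIn u W * 2 ^ W'.card ≤ outPairIn u W' * 2 ^ W.card := by
  have hc : (W \ W').card + W'.card = W.card := card_sdiff_add_card_eq_card h
  calc outPairIn u W * 2 ^ W'.card ≤ (2 ^ (W \ W').card * outPairIn u W') * 2 ^ W'.card :=
        Nat.mul_le_mul_right _ (outPairIn_le_mul u hu h)
    _ = outPairIn u W' * 2 ^ W.card := by rw [← hc, pow_add]; ring

/-! ### 2. Pattern counts as single sums over the first cell -/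

/-- `#{X ∈ u, Y ∉ u, Z ∉ u} = Σ_{X ∈ u} outPairIn u Xᶜ`. [this work] -/
theorem triCount_fst_outPair_eq (u : Finset ι → Bool) :
    triCount u (fun a b d => a && (!b && !d)) = ∑ x : Finset ι, if u x = true then outPairIn u xᶜ else 0 := by
  unfold triCount outPairIn
  refine sum_congr rfl fun x _ => ?_
  rcases hx : u x with _ | _ <;> simp

/-- `#{Y ∉ u, Z ∉ u} = Σ_X outPairIn u Xᶜ`. [this work] -/
theorem triCount_outPair_eq (u : Finset ι → Bool) :
    triCount u (fun _ b d => !b && !d) = ∑ x : Finset ι, outPairIn u xᶜ := rfl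

/-! ### 3. The both-out inequality -/

/-- **THEOREM (both-out).**  For a monotone property `u` and a uniform random ordered tripartition `(X,Y,Z)`:
`P(X ∈ u)·P(Y ∉ u, Z ∉ u) ≤ P(X ∈ u, Y ∉ u, Z ∉ u)` — conditioning on the first cell being a member makes it MORE likely that the other two are
both non-members.  Proof: the non-member-pair density of `2^{Xᶜ}` is monotone in `X`; FKG with the log-modular weight `2^{|Xᶜ|}`. [this work] -/
theorem triCount_fst_mul_outPair_le (u : Finset ι → Bool) (hu : Monotone u) :
    triCount u (fun a _ _ => a) * triCount u (fun _ b d => !b && !d) ≤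
      triCount u (fun _ _ _ => true) * triCount u (fun a b d => a && (!b && !d)) := by
  classical
  set μ : Finset ι → ℚ := fun x => 2 ^ xᶜ.card with hμ
  set f : Finset ι → ℚ := fun x => if u x = true then 1 else 0 with hf
  set g : Finset ι → ℚ := fun x => (outPairIn u xᶜ : ℚ) / 2 ^ xᶜ.card with hg
  have hμ0 : 0 ≤ μ := fun x => by positivity
  have hf0 : 0 ≤ f := fun x => by simp only [hf, Pi.zero_apply]; split_ifs <;> norm_num
  have hg0 : 0 ≤ g := fun x => by simp only [hg, Pi.zero_apply]; positivity
  have hfm : Monotone f := by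
    intro x y hxy
    simp only [hf]
    split_ifs with h1 h2 <;> norm_num
    exact absurd (le_antisymm (Bool.le_true _) (h1 ▸ hu hxy)) h2
  have hgm : Monotone g := by
    intro x y hxy
    simp only [hg]
    have hsub : yᶜ ⊆ xᶜ := compl_subset_compl.mpr hxy
    have key := outPairIn_mul_pow_le u hu hsub
    rw [div_le_div_iff₀ (by positivity) (by positivity)]
    exact_mod_cast key
  have hμl : ∀ a b, μ a * μ b ≤ μ (a ⊓ b) * μ (a ⊔ b) := by
    intro a b
    simp only [hμ, ← pow_add]
    apply le_of_eq
    congr 1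
    rw [inf_eq_inter, sup_eq_union, compl_inter, compl_union, add_comm (aᶜ ∪ bᶜ).card,
      card_inter_add_card_union]
  have FKG := fkg (μ := μ) (f := f) (g := g) hμ0 hf0 hg0 hfm hgm hμl
  have s1 : ∑ x, μ x * f x = ∑ x : Finset ι, if u x = true then (2 : ℚ) ^ xᶜ.card else 0 := by
    refine sum_congr rfl fun x _ => ?_; simp only [hμ, hf]; split_ifs <;> ring
  have s2 : ∑ x, μ x * g x = ∑ x : Finset ι, (outPairIn u xᶜ : ℚ) := by
    refine sum_congr rfl fun x _ => ?_
    simp only [hμ, hg]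
    rw [mul_div_cancel₀ _ (by positivity)]
  have s3 : ∑ x, μ x = ∑ x : Finset ι, (2 : ℚ) ^ xᶜ.card := rfl
  have s4 : ∑ x, μ x * (f x * g x) = ∑ x : Finset ι, if u x = true then (outPairIn u xᶜ : ℚ) else 0 := by
    refine sum_congr rfl fun x _ => ?_
    simp only [hμ, hf, hg]
    split_ifs
    · rw [one_mul, mul_div_cancel₀ _ (by positivity)]
    · ring
  rw [s1, s2, s3, s4] at FKG
  rw [triCount_fst_outPair_eq, triCount_true_eq, triCount_fst_eq, triCount_outPair_eq]
  have e11 : ((∑ x : Finset ι, if u x = true then outPairIn u xᶜ else 0 : ℕ) : ℚ)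
      = ∑ x : Finset ι, if u x = true then (outPairIn u xᶜ : ℚ) else 0 := by
    push_cast; refine sum_congr rfl fun x _ => ?_; split_ifs <;> simp
  have e10 : ((∑ x : Finset ι, if u x = true then 2 ^ xᶜ.card else 0 : ℕ) : ℚ)
      = ∑ x : Finset ι, if u x = true then (2 : ℚ) ^ xᶜ.card else 0 := by
    push_cast; refine sum_congr rfl fun x _ => ?_; split_ifs <;> simp
  have e00 : ((∑ x : Finset ι, 2 ^ xᶜ.card : ℕ) : ℚ) = ∑ x : Finset ι, (2 : ℚ) ^ xᶜ.card := by push_cast; rfl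
  have e01 : ((∑ x : Finset ι, outPairIn u xᶜ : ℕ) : ℚ) = ∑ x : Finset ι, (outPairIn u xᶜ : ℚ) := by push_cast; rfl
  have goal : ((∑ x : Finset ι, if u x = true then 2 ^ xᶜ.card else 0 : ℕ) : ℚ) * ((∑ x : Finset ι, outPairIn u xᶜ : ℕ) : ℚ)
      ≤ ((∑ x : Finset ι, 2 ^ xᶜ.card : ℕ) : ℚ) * ((∑ x : Finset ι, if u x = true then outPairIn u xᶜ else 0 : ℕ) : ℚ) := by
    rw [e11, e10, e00, e01]
    exact FKG
  exact_mod_cast goal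

end SahiTripartition

end Summit.CriticalPhenomena.PercolationContinuityZ3.Theorems
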